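import Summits.Parity.GeneralizedHardyLittlewood.Theses.RoughSemiprimeRigidity

/-!
# Line `birth` — BC3 skeleton for the crux `RoughSemiprimeTwins` (stmt-Parity-9380)

Route `RoughSemiprimeRigidity` (route-Parity-RoughSemiprimeRigidity), sub-problem `GeneralizedHardyLittlewood`,
crux (rank 2, by name `Summit.Parity.GeneralizedHardyLittlewood.Theses.RoughSemiprimeRigidity.RoughSemiprimeTwins`):
for every even `h ≥ 2`,

  `S_h(N) := Σ_{n ≤ N} W(n) W(n+h) = ¼ · 𝔖({0,h}) · N log² N + o(N log² N)`,

`W(m) = 2 log q log p` if `m = qp` with primes `m^{1/4} < q < p` and `W(m) = 0` otherwise (log-weighted rough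
semiprimes, `η = ¼`), `𝔖 = Literature.NumberTheory.Sieve.singularSeries` (Hardy–Littlewood pair series).

## The line: SIEVE-UPPER × PARITY-LOWER (the one axis along which sieve theory cuts a pair asymptotic)

The little-o asymptotic of the real sequence `S_h(N)` against the gauge `N log² N` is EXACTLY the conjunction of a
sharp upper density and a sharp lower density (pure real analysis, `crux_iff_stubs` below); `S_h` is a sum of
non-negative terms (the natural habitat of upper-bound sieves), and the two halves belong to different theories:

* `stub_upperBound` (U) — for every even `h` and `ε > 0`, eventually `S_h(N) ≤ (¼𝔖(h) + ε) · N log² N`.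
  This is the UPPER-BOUND-SIEVE half WITH THE SHARP CONSTANT. A dimension-one upper-bound sieve (Selberg Λ² /
  Rosser–Iwaniec) on the prime cofactor `p` of `n = qp`, fed by the distribution of the shifted weight
  `n ↦ W(n+h)` over the multiples of `qd` (exactly the (A₂)-data of the route's `RoughSemiprimeBombieri`), gives
  (U) with `¼𝔖` inflated by the factor `2/ϑ`, `ϑ` = level of distribution RELATIVE to the length `N/q` of the
  sifted variable: some explicit finite factor unconditionally (level `½` for products of two Siegel–Walfisz
  factors, Motohashi / Polymath8b Thm 2.7(iii), i.e. `ϑ = (½ − λ)/(1 − λ)` at `q = N^λ`, outside the balanced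
  corner `q ≈ √N`, plus a crude two-dimensional sieve on the corner), and the factor `2` exactly under
  `RoughSemiprimeBombieri` itself (level `x^{1−ε}` for every `ε`, so `ϑ → 1`). Beating the factor `2` is Selberg's parity phenomenon for upper
  bounds; the factor `1` is (U). Under EH + RoughSemiprimeBombieri the crux `TwoSidedRigidity` (rank 3) turns (U)
  into `Σ_{n≤N} Λ(n)Λ(n+h) ≤ (1+o(1))·𝔖(h)·N`, the SHARP SIEVE UPPER BOUND FOR PRIME PAIRS (known factor 4 from
  Selberg's sieve + Bombieri–Vinogradov, ≈ 3.4 after Chen / Fouvry–Grupp / Wu by switching and Kloosterman-level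
  inputs, 2 under EH), i.e. `α_h ≤ 1` for Bombieri's twin parameter. Why rough SEMIPRIMES are the better place to
  fight for the constant: `W` is a bilinear convolution `Λ_Q ⋆ Λ_P` with flexible factor sizes
  `q ∈ (N^{1/4}, N^{1/2})`, the shape for which the dispersion method and Kloosterman-sum bounds reach moduli
  beyond `x^{1/2}` for a fixed residue class (BombieriFriedlanderIwaniecActa1986, Fouvry–Iwaniec), which `Λ` alone
  lacks — every gain in admissible level for `W(·+h)` lowers the provable factor in (U) (a ladder of landable
  `--supports` results: explicit `C`, then `2 + ε`, then `2` ⟺ the GEH-instance; `1` = this stub).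
* `stub_lowerBound` (L) — for every even `h` and `ε > 0`, eventually `S_h(N) ≥ (¼𝔖(h) − ε) · N log² N`.
  This is the PARITY half: under EH + RoughSemiprimeBombieri + TwoSidedRigidity it reads `α_h ≥ 1`, i.e. the
  full Hardy–Littlewood lower bound for prime pairs at shift `h`; and for the rough cell (`η = ¼`, `W⁻W⁻ = ¼`)
  Bombieri's rank-one law `E_h[W ⊗ W] = ¼·α_h` shows that even a POSITIVE-PROPORTION lower bound is
  twin-prime-existence-hard (the sieve lower bound is the `α_h = 0` value, zero) — no Chen-type partial result
  lives at this roughness; the ladder here is roughness `η ↓` (cells with `W⁻ < ½`), a different statement.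

`RoughSemiprimeTwins_of_bounds : (U) → (L) → ‹the crux, respelled›` is a real proof (two-sided eventual bounds
against the non-negative gauge `N log² N` ⟹ `IsLittleO`; hypothesis form), `RoughSemiprimeTwins_of : RoughSemiprimeTwins`
instantiates it on the two stubs and concludes the crux BY NAME (the skeleton theorem: zero hypotheses, no direct
`sorry` — the audit `#h21_check_skeleton` admits only registered obligations as hypotheses of the by-name theorem,
code `skeleton.extra-hypothesis`, so the raw-signature form cannot itself be the by-name theorem), and
`crux_iff_stubs : RoughSemiprimeTwins ↔ (U) ∧ (L)` (sorry-free) certifies that the split is EXACT: both stubs are consequences of the crux, so neither is refutable short of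
`¬RoughSemiprimeTwins` (which, given EH ∧ RoughSemiprimeBombieri, is `¬HL(h)` — route KILL CRITERIA), and no
difficulty hides in an unnamed step. Neither stub is the crux or the summit in costume: (U) holds trivially if
`S_h` were too small and (L) if it were too large; BC3 probes `stub → RoughSemiprimeTwins` and
`stub → GeneralizedHardyLittlewood` by `first | exact? | simpa | aesop` FAIL (registrar's folder `bc/probes.lean`,
verdicts quoted in `Lines/birth.md`).

Foreseen layer 2 (NOT filed; route header TWO-LAYER PLAN "BalancedBoxes → UnbalancedBoxes → glue"): each of (U), (L)
splits additively over the boxes of the determinant equation `q′p′ − qp = h` by the size of the smaller primes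
(`q, q′ > n^{3/8}`: all four primes in `(n^{3/8}, n^{5/8})`, DFI determinant method / bilinear Kloosterman forms;
otherwise a prime variable `≥ n^{5/8}`, dispersion), with local means `¼ log n` per half-range and box constants
`(1/16)·𝔖(h)`.

Numerics on file (item evidence RoughTwinsNumerics.md, out_1e9; refuters g43-17/g43-34): `S_h(N)/(¼𝔖(h)N log²N)`
= 0.74 (10⁶) → 0.80 (10⁷) → 0.82 (3·10⁷) → rising as `1 − c/log N`, h-uniform for h ∈ {2,…,30}; against the HL
model with the exact finite-N density of `W` the ratio is 0.998 — consistent with (U) and (L), no signal against ¼.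

Disproof used: none on file (`ledger crux ls stmt-Parity-9380`: no workfiles, no `Disproof.lean`, no `Negative/`
lemma at registration, 2026-08-17). Negatives index (`ledger negatives --problem Parity`: stmt-Parity-9541
ConvMomentLevelOne, stmt-Parity-14832 TupleElliott, stmt-Parity-4218 RectangleChowla): none is an upper/lower
density statement for a pair cell; no stub restates one.

`sorry` occurs ONLY in `stub_upperBound` and `stub_lowerBound` (sorries = 2 = stubs); everything else is
kernel-checked. `crux_iff` certifies by `Iff.rfl` that the `W`/`S`/`sing` spelling below IS the crux's `let W` spelling.
-/

namespace Summit.Parity.GeneralizedHardyLittlewood.Cruxes.RoughSemiprimeTwins.Birth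

open Filter Finset Asymptotics
open scoped BigOperators Topology
open Summit.Parity.GeneralizedHardyLittlewood.Theses.RoughSemiprimeRigidity (RoughSemiprimeTwins)

/-! ## The crux's objects, named (verbatim the `let`s of the route file) -/

/-- The route's log-weighted rough-semiprime weight (`η = ¼`): `W(m) = 2 log q log p` for `m = qp`,
primes `m^{1/4} < q < p`; `0` otherwise. Verbatim the `let W` of `RoughSemiprimeTwins`. -/
noncomputable def W (m : ℕ) : ℝ :=
  ∑ q ∈ m.primeFactors,
    if (m / q).Prime ∧ q < m / q ∧ m < q ^ 4 then 2 * Real.log q * Real.log ((m / q : ℕ) : ℝ) else 0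

/-- The rough-semiprime twin cell at shift `h`: `S_h(N) = Σ_{1 ≤ n ≤ N} W(n) W(n+h)`. -/
noncomputable def S (h N : ℕ) : ℝ := ∑ n ∈ Finset.Icc 1 N, W n * W (n + h)

/-- The Hardy–Littlewood singular series of the pair `{0, h}` (tree definition, by name). -/
noncomputable def sing (h : ℕ) : ℝ :=
  Literature.NumberTheory.Sieve.singularSeries ({0, (h : ℤ)} : Finset ℤ)

/-- The crux, respelled with `S` and `sing`: definitionally the route decl (`Iff.rfl`). [folklore] -/
theorem crux_iff :
    RoughSemiprimeTwins ↔
      ∀ h : ℕ, 1 ≤ h → Even h →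
        (fun N : ℕ => S h N - (1 / 4 : ℝ) * sing h * N * Real.log N ^ 2) =o[Filter.atTop]
          fun N : ℕ => (N : ℝ) * Real.log N ^ 2 :=
  Iff.rfl

/-! ## The two registered OPEN stubs -/

/-- **Stub U — sharp upper density (the upper-bound-sieve half, with the sharp constant).**
For every even `h ≥ 2` and `ε > 0`: `S_h(N) ≤ (¼𝔖(h) + ε)·N log²N` for all large `N`.
Implied by the crux (`stubs_of_crux`). Upper-bound sieves give it with `¼𝔖` inflated by the factor `2/ϑ` of
their relative level `ϑ` (factor 2 exactly under the route's GEH-instance `RoughSemiprimeBombieri`); the factor 1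
is the parity phenomenon for upper bounds. Under EH + RoughSemiprimeBombieri + TwoSidedRigidity it reads
`Σ_{n≤N} Λ(n)Λ(n+h) ≤ (1+o(1))𝔖(h)N`, the sharp sieve upper bound for prime pairs (`α_h ≤ 1`). Why it might fail: only if `S_h` had upper density above HL along a subsequence — excess clustering
of rough-semiprime pairs at one shift, contradicting HL(h) under EH ∧ GEH by the route's rigidity.
Sources: BombieriAsymptoticSieve1976, BombieriFriedlanderIwaniecActa1986, Polymath8b2014, HalberstamRichert1974,
arXiv:2102.12297. -/
theorem stub_upperBound :
    ∀ h : ℕ, 1 ≤ h → Even h → ∀ ε : ℝ, 0 < ε → ∀ᶠ N : ℕ in Filter.atTop,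
      S h N ≤ ((1 / 4 : ℝ) * sing h + ε) * ((N : ℝ) * Real.log N ^ 2) := by
  sorry

/-- **Stub L — sharp lower density (the parity half).**
For every even `h ≥ 2` and `ε > 0`: `S_h(N) ≥ (¼𝔖(h) − ε)·N log²N` for all large `N`.
Implied by the crux (`stubs_of_crux`). Under EH + RoughSemiprimeBombieri + TwoSidedRigidity it is the full
Hardy–Littlewood lower bound for prime pairs at shift `h` (`α_h ≥ 1`); by Bombieri's rank-one law for the rough
cell (`W⁻W⁻ = ¼`, `E_h[W⊗W] = ¼α_h`) even a positive-proportion lower bound at this roughness is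
twin-prime-existence-hard (the sieve lower bound is the `α_h = 0` value, zero). Why it might fail: it is the
positive parity input of the whole route; false for one even `h` iff (given EH ∧ RoughSemiprimeBombieri ∧ U) HL(h)
fails from below. Sources: BombieriAsymptoticSieve1976, Friedlander2006ProducingPrimes, HardyLittlewood1923,
arXiv:2102.12297, Polymath8b2014. -/
theorem stub_lowerBound :
    ∀ h : ℕ, 1 ≤ h → Even h → ∀ ε : ℝ, 0 < ε → ∀ᶠ N : ℕ in Filter.atTop,
      ((1 / 4 : ℝ) * sing h - ε) * ((N : ℝ) * Real.log N ^ 2) ≤ S h N := by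
  sorry

/-! ## The composition: the two stubs prove the crux BY NAME -/

/-- **Composition, hypothesis form (sorry-free).** Sharp upper density (U) and sharp lower density (L) against
the non-negative gauge `N log²N` give the little-o asymptotic — the crux in the `S`/`sing` spelling of `crux_iff`.
The hypotheses are literally the statements of `stub_upperBound` and `stub_lowerBound`. [folklore] -/
theorem RoughSemiprimeTwins_of_bounds
    (hU : ∀ h : ℕ, 1 ≤ h → Even h → ∀ ε : ℝ, 0 < ε → ∀ᶠ N : ℕ in Filter.atTop,
      S h N ≤ ((1 / 4 : ℝ) * sing h + ε) * ((N : ℝ) * Real.log N ^ 2))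
    (hL : ∀ h : ℕ, 1 ≤ h → Even h → ∀ ε : ℝ, 0 < ε → ∀ᶠ N : ℕ in Filter.atTop,
      ((1 / 4 : ℝ) * sing h - ε) * ((N : ℝ) * Real.log N ^ 2) ≤ S h N) :
    ∀ h : ℕ, 1 ≤ h → Even h →
      (fun N : ℕ => S h N - (1 / 4 : ℝ) * sing h * N * Real.log N ^ 2) =o[Filter.atTop]
        fun N : ℕ => (N : ℝ) * Real.log N ^ 2 := by
  intro h hh he
  rw [Asymptotics.isLittleO_iff]
  intro c hc
  filter_upwards [hU h hh he c hc, hL h hh he c hc] with N h1 h2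
  have g0 : 0 ≤ (N : ℝ) * Real.log N ^ 2 := by positivity
  rw [Real.norm_eq_abs, Real.norm_eq_abs, abs_of_nonneg g0, abs_le]
  constructor <;> linarith

/-- **THE SKELETON THEOREM.** The crux
`Summit.Parity.GeneralizedHardyLittlewood.Theses.RoughSemiprimeRigidity.RoughSemiprimeTwins`, concluded BY NAME
from the two declared stubs through the sorry-free composition `RoughSemiprimeTwins_of_bounds` and the
definitional respelling `crux_iff`. (`sorry` enters only through the stub constants.) [folklore] -/
theorem RoughSemiprimeTwins_of : RoughSemiprimeTwins :=
  crux_iff.2 (RoughSemiprimeTwins_of_bounds stub_upperBound stub_lowerBound)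

/-! ## Exactness of the split (sorry-free): both stubs follow from the crux -/

/-- Both stub statements follow from the crux (so a refutation of either stub refutes the crux itself).
[folklore] -/
theorem stubs_of_crux (H : RoughSemiprimeTwins) :
    (∀ h : ℕ, 1 ≤ h → Even h → ∀ ε : ℝ, 0 < ε → ∀ᶠ N : ℕ in Filter.atTop,
      S h N ≤ ((1 / 4 : ℝ) * sing h + ε) * ((N : ℝ) * Real.log N ^ 2)) ∧
    (∀ h : ℕ, 1 ≤ h → Even h → ∀ ε : ℝ, 0 < ε → ∀ᶠ N : ℕ in Filter.atTop,
      ((1 / 4 : ℝ) * sing h - ε) * ((N : ℝ) * Real.log N ^ 2) ≤ S h N) := by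
  rw [crux_iff] at H
  refine ⟨fun h hh he ε hε => ?_, fun h hh he ε hε => ?_⟩
  all_goals
    have H1 := (Asymptotics.isLittleO_iff.1 (H h hh he)) hε
    filter_upwards [H1] with N hN
    have g0 : 0 ≤ (N : ℝ) * Real.log N ^ 2 := by positivity
    rw [Real.norm_eq_abs, Real.norm_eq_abs, abs_of_nonneg g0, abs_le] at hN
    obtain ⟨hN1, hN2⟩ := hN
    linarith

/-- **Exactness.** The crux is EQUIVALENT to the conjunction of the two stub statements. [folklore] -/
theorem crux_iff_stubs :
    RoughSemiprimeTwins ↔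
    ((∀ h : ℕ, 1 ≤ h → Even h → ∀ ε : ℝ, 0 < ε → ∀ᶠ N : ℕ in Filter.atTop,
      S h N ≤ ((1 / 4 : ℝ) * sing h + ε) * ((N : ℝ) * Real.log N ^ 2)) ∧
    (∀ h : ℕ, 1 ≤ h → Even h → ∀ ε : ℝ, 0 < ε → ∀ᶠ N : ℕ in Filter.atTop,
      ((1 / 4 : ℝ) * sing h - ε) * ((N : ℝ) * Real.log N ^ 2) ≤ S h N)) :=
  ⟨stubs_of_crux, fun hUL => crux_iff.2 (RoughSemiprimeTwins_of_bounds hUL.1 hUL.2)⟩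

end Summit.Parity.GeneralizedHardyLittlewood.Cruxes.RoughSemiprimeTwins.Birth
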